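import Mathlib.Analysis.Complex.ExponentialBounds
import Mathlib.Analysis.Real.Pi.Bounds

/-!
# K1loc, line `Spectral` / thin start — helper: NUMERIC CONSTANTS OF THE LEDGER INSTANCE (S-D, «NumericConstants»)

Helper file of the prover lane on the crux `K1LocalisedCascade` (stmt-AnomalousDissipation-19491), route
`SawtoothPulseCascade` (concrete ledger assembly at `γ = 8`).  Decimal bounds for the transcendental constants that occur in the
landed step theorems, so that the concrete instance discharges its side conditions by `norm_num`/`linarith`:
* `exp_half_le` (`e^{1/2} ≤ 1.649`) and `two_mul_exp_half_sub_one_le` (`2e^{1/2} − 1 ≤ 23/10`; the rounding constant of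
  `…ChirpRounding.abs_U_sub_exactProfile_le` / `…ChirpSidebandEnergy`);
* `exp_neg_le_pow_of_le` (`e^{−x} ≤ 0.3678794412^m` for `m ≤ x`; the corner-zone factor `e^{−M²/2}` of `…HalfStepVT`);
* `eight_div_pi_sq_le` / `four_div_pi_sq_le` (`8/π² ≤ 73/90`, `4/π² ≤ 73/180`; the sideband constants of `…SidebandEnergy(Parity)`);
* `four_div_pi_le` / `two_div_pi_le` / `inv_pi_le` (`4/π ≤ 51/40`, `2/π ≤ 0.6367`, `1/π ≤ 0.3184`; the log-type kernel constant of
  `…TrapezoidLog`; `1/π² ≤ 0.101322` is `…PhaseOneStartSeries.inv_pi_sq_le`).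
Pure numerics; no definitions; nothing about the crux. [cite: Folland1999, Prop. 2.53] [problem: turb]
-/

-- `Summit.<Summit>.<Problem>`: single-conjunct summit, the duplicate namespace segment is deliberate.
set_option linter.dupNamespace false

noncomputable section

namespace Summit.AnomalousDissipation.AnomalousDissipation.Theorems.SawtoothPulseCascade.K1Start

open Real

/-! ## §1 The rounding constant `2e^{1/2} − 1` -/

/-- `e^{1/2} ≤ 1.649` (since `(e^{1/2})² = e < 2.7182818286 < 1.649²`). [folklore] -/
theorem exp_half_le : Real.exp (1 / 2) ≤ 1649 / 1000 := by
  have hsq : Real.exp (1 / 2) * Real.exp (1 / 2) = Real.exp 1 := by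
    rw [← Real.exp_add]; norm_num
  have he := Real.exp_one_lt_d9
  have hpos := Real.exp_pos (1 / 2)
  by_contra h
  push Not at h
  nlinarith [mul_lt_mul'' h h (by norm_num) (by norm_num)]

/-- `2e^{1/2} − 1 ≤ 23/10` — the constant of `|S_δ(θ) − tri θ| ≤ (2e^{1/2} − 1)δ`. [folklore] -/
theorem two_mul_exp_half_sub_one_le : 2 * Real.exp (1 / 2) - 1 ≤ 23 / 10 := by
  linarith [exp_half_le]

/-- `1 ≤ 2e^{1/2} − 1` (the rounding constant is at least `1`). [folklore] -/
theorem one_le_two_mul_exp_half_sub_one : 1 ≤ 2 * Real.exp (1 / 2) - 1 := by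
  have h : 1 ≤ Real.exp (1 / 2) := Real.one_le_exp (by norm_num)
  linarith

/-! ## §2 The corner-zone factor `e^{−M²/2}` -/

/-- `e^{−x} ≤ e^{−m} ≤ 0.3678794412^m` whenever `m ≤ x` (`m ∈ ℕ`). [folklore] -/
theorem exp_neg_le_pow_of_le {x : ℝ} {m : ℕ} (h : (m : ℝ) ≤ x) :
    Real.exp (-x) ≤ (0.3678794412 : ℝ) ^ m := by
  have h1 : Real.exp (-x) ≤ Real.exp (-(m : ℝ)) := Real.exp_le_exp.2 (by linarith)
  have h2 : Real.exp (-(m : ℝ)) = Real.exp (-1) ^ m := by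
    rw [← Real.exp_nat_mul]; congr 1; ring
  have h3 : Real.exp (-1) ^ m ≤ (0.3678794412 : ℝ) ^ m :=
    pow_le_pow_left₀ (Real.exp_pos _).le Real.exp_neg_one_lt_d9.le m
  exact h1.trans (h2 ▸ h3)

/-- `e^{−M²/2} ≤ 0.3678794412^m` whenever `2m ≤ M²`. [folklore] -/
theorem exp_neg_sq_half_le_pow {M : ℝ} {m : ℕ} (h : 2 * (m : ℝ) ≤ M ^ 2) :
    Real.exp (-(M ^ 2 / 2)) ≤ (0.3678794412 : ℝ) ^ m :=
  exp_neg_le_pow_of_le (by linarith)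

/-! ## §3 `π`-constants of the sideband and kernel bounds -/

/-- `8/π² ≤ 73/90` (`≈ 0.8106 ≤ 0.8111`). [folklore] -/
theorem eight_div_pi_sq_le : 8 / π ^ 2 ≤ 73 / 90 := by
  have hπ := Real.pi_gt_d4
  have hπ2 : (9.86902 : ℝ) < π ^ 2 := by nlinarith
  rw [div_le_div_iff₀ (by positivity) (by norm_num)]
  nlinarith

/-- `4/π² ≤ 73/180`. [folklore] -/
theorem four_div_pi_sq_le : 4 / π ^ 2 ≤ 73 / 180 := by
  have h := eight_div_pi_sq_le
  have e : 4 / π ^ 2 = (8 / π ^ 2) / 2 := by ring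
  rw [e]; linarith

/-- `1/π ≤ 0.3184`. [folklore] -/
theorem inv_pi_le : 1 / π ≤ 0.3184 := by
  have hπ := Real.pi_gt_d4
  rw [div_le_iff₀ Real.pi_pos]
  nlinarith

/-- `2/π ≤ 0.6367`. [folklore] -/
theorem two_div_pi_le : 2 / π ≤ 0.6367 := by
  have hπ := Real.pi_gt_d4
  rw [div_le_iff₀ Real.pi_pos]
  nlinarith

/-- `4/π ≤ 51/40` (`≈ 1.2733 ≤ 1.275`). [folklore] -/
theorem four_div_pi_le : 4 / π ≤ 51 / 40 := by
  have hπ := Real.pi_gt_d4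
  rw [div_le_div_iff₀ Real.pi_pos (by norm_num)]
  nlinarith

end Summit.AnomalousDissipation.AnomalousDissipation.Theorems.SawtoothPulseCascade.K1Start
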